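import Mathlib
import Summits.CriticalPhenomena.PercolationContinuityZ3.Theorems.PercNearOneGluingNoHeavyLowerTailPendantStarGluing
import Summits.CriticalPhenomena.PercolationContinuityZ3.Theorems.PercNearOneGluingAdditiveGluingBlockGrowth
import Literature.Probability.Percolation.KozmaNitzanHittable
import HarnessLib

/-!
# `NoHeavyLowerTail` (stmt-CriticalPhenomena-4575) — Conjecture 3 for observers inside a CORE whose exterior is
# depth-two: `μ(o ↮ b) ≤ μ(o ↮ A) + √t + Σ_{z ∈ O∖{o}} μ(o ↮ z)`

Support file (depth prover `nh-dp-blobmono`, respawn g5; `--supports stmt-CriticalPhenomena-4575`).  No definitions,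
no named facts, no sorries.  Sequel to `…PendantStarGluing.lean` (observer bridge + pendant-star gluing).

`μ = prodBernoulli w` on `Fin n`, relays `A ∋ b`, an observer SET ("core") `O` disjoint from `A` whose exterior is
depth-two: every non-relay `x ∉ O` with a positive-weight pair to `O` has all its other positive-weight pairs in
`O ∪ A` (pendant Steiner stars of the core).  Inside `O` the graph is arbitrary.

* `glue_real_blockReachA` — gluing the core does not change `μ(O ↔ A)` (pushforward `stub_gluePushforward` +
  `stub_glueReach`; companion of `blockGrowth_glue_real_iUnion` for `μ(O ↔ b)`).
* `coreGluing` — `μ(O ↔ A) − μ(O ↔ b) ≤ max_a μ_{G−O}(a ↮ b)` IN THE TRUE LAW (`pendantStarGluing_block` + glue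
  invariance).
* `coreBridge` — `μ(O ↮ b) · μ_{G−O}(a ↮ b) ≤ μ(a ↮ b)` for `a ∉ O` (Harris; set version of `observerBridge`).
* `core_nearOneGluing` — **`μ(O ↮ b) ≤ μ(O ↮ A) + √t`** (`t ≥ μ(a ↮ b)` for all `a ∈ A`).
* `coreObserver_nearOneGluing` — for `o ∈ O`: **`μ(o ↮ b) ≤ μ(o ↮ A) + √t + Σ_{z ∈ O∖{o}} μ(o ↮ z)`**:
  Kozma–Nitzan's Conjecture 3 for every observer that sits, up to the cohesion defect `Σ_z μ(o ↮ z)`, inside a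
  block whose outside neighbours are relays and pendant stars — "depth two modulo a reliable core" (e.g. `o`
  glued to a hub whose other neighbours are relays and pendant stars), uniformly in `|O|`-free quantities except
  the explicit cohesion sum, in the number of stars and in `|A|`.
-/

namespace Summit.CriticalPhenomena.PercolationContinuityZ3.Theorems

open MeasureTheory Set
open Literature.Probability.LatticeModels (prodBernoulli prodBernoulli_real_mono_of_isUpperSet
  prodBernoulli_harris_lower)
open Literature.Probability.Percolation (BondConfig openConn openConnIn openGraph isUpperSet_openConn
  isUpperSet_openConnIn restrW wireSet)

noncomputable section
open Classical

variable {n : ℕ}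

/-! ### Glue invariance of the core's reach of `A` -/

/-- Gluing the block does not change the event "the block reaches `A`": `μ_{glue w O}(O ↔ A) = μ(O ↔ A)`.
[folklore; cite: KozmaNitzan2024, §3.1 (gluing, Remark p. 5)] -/
theorem glue_real_blockReachA (w : Sym2 (Fin n) → unitInterval) (O A : Finset (Fin n)) :
    (prodBernoulli (fun e : Sym2 (Fin n) => if (∀ x ∈ e, x ∈ O) ∧ ¬ e.IsDiag then 1 else w e)).real
        (⋃ o ∈ O, ⋃ x ∈ A, openConn o x) =
      (prodBernoulli w).real (⋃ o ∈ O, ⋃ x ∈ A, (openConn o x : Set (BondConfig (Fin n)))) := by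
  rw [stub_gluePushforward n w O]
  congr 1
  ext ω
  simp only [Set.mem_setOf_eq, Set.mem_iUnion, exists_prop]
  constructor
  · rintro ⟨o, ho, x, hx, h⟩
    rcases (stub_glueReach n O ω o x).1 h with h | ⟨-, s', hs', h'⟩
    · exact ⟨o, ho, x, hx, h⟩
    · exact ⟨s', hs', x, hx, h'⟩
  · rintro ⟨o, ho, x, hx, h⟩
    exact ⟨o, ho, x, hx, (stub_glueReach n O ω o x).2 (Or.inl h)⟩

/-! ### Gluing for a core with depth-two exterior, in the true law -/

/-- **Core gluing.**  Core `O` disjoint from `A ∋ b` with depth-two exterior; if `μ_{G−O}(a ↮ b) ≤ θ` for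
all `a ∈ A` (pairs meeting `O` given weight `0`) then `μ(O ↔ A) − μ(O ↔ b) ≤ θ`.
[this work; cite: KozmaNitzan2024, Thm. 4 (p. 12)] -/
theorem coreGluing (w : Sym2 (Fin n) → unitInterval) (O A : Finset (Fin n)) (b : Fin n) (θ : ℝ)
    (hbA : b ∈ A) (hOA : Disjoint O A)
    (hpend : ∀ x : Fin n, x ∉ O → x ∉ A → (∃ o ∈ O, w s(o, x) ≠ 0) →
      ∀ y : Fin n, y ∉ O → y ∉ A → y ≠ x → w s(x, y) = 0)
    (hrel : ∀ a ∈ A, (prodBernoulli (fun e : Sym2 (Fin n) =>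
      if (∃ x ∈ e, x ∈ O) then 0 else w e)).real (openConn a b)ᶜ ≤ θ) :
    (prodBernoulli w).real (⋃ o ∈ O, ⋃ x ∈ A, (openConn o x : Set (BondConfig (Fin n)))) -
      (prodBernoulli w).real (⋃ o ∈ O, (openConn o b : Set (BondConfig (Fin n)))) ≤ θ := by
  have key := pendantStarGluing_block w O A b θ hbA hOA hpend hrel
  rw [glue_real_blockReachA w O A, blockGrowth_glue_real_iUnion w O b] at key
  exact key

/-! ### The set bridge -/

/-- If `a ↔ b` but no vertex of `O` reaches `b` then `a ↔ b` off `O`. [folklore] -/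
theorem openConn_diff_blockReach_subset_openConnIn (O : Finset (Fin n)) (a b : Fin n) :
    (openConn a b : Set (BondConfig (Fin n))) ∩ (⋃ o ∈ O, (openConn o b : Set (BondConfig (Fin n))))ᶜ ⊆
      openConnIn ((↑O : Set (Fin n))ᶜ) a b := by
  rintro ω ⟨hab, hOb⟩
  refine Literature.Probability.Percolation.KNGoodAux.openConnIn_of_reachable_of_forall_mem hab ?_
  intro y hay hyO
  exact hOb (Set.mem_iUnion₂.2 ⟨y, hyO, hay.symm.trans hab⟩)

/-- `μ_{G−O}(a ↮ b) ≤ μ(a ↮ b off O)` for `a ∉ O` (the deleted weights dominate the restriction to `Oᶜ`).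
[folklore] -/
theorem kill_compl_le_openConnIn (w : Sym2 (Fin n) → unitInterval) (O : Finset (Fin n)) (a b : Fin n)
    (haO : a ∉ O) :
    (prodBernoulli (fun e : Sym2 (Fin n) => if (∃ x ∈ e, x ∈ O) then 0 else w e)).real (openConn a b)ᶜ ≤
      (prodBernoulli w).real (openConnIn ((↑O : Set (Fin n))ᶜ) a b)ᶜ := by
  have hle : restrW ((↑O : Set (Fin n))ᶜ) w ≤
      (fun e : Sym2 (Fin n) => if (∃ x ∈ e, x ∈ O) then 0 else w e) := by
    intro e
    show restrW ((↑O : Set (Fin n))ᶜ) w e ≤ (if (∃ x ∈ e, x ∈ O) then (0 : unitInterval) else w e)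
    by_cases h : ∃ x ∈ e, x ∈ O
    · rw [if_pos h]
      have hnot : e ∉ wireSet ((↑O : Set (Fin n))ᶜ) := by
        obtain ⟨x, hx, hxO⟩ := h
        intro hw
        exact (hw.1 x hx) (Finset.mem_coe.2 hxO)
      rw [Literature.Probability.Percolation.restrW_apply_of_not_mem w hnot]
    · rw [if_neg h]
      by_cases hw : e ∈ wireSet ((↑O : Set (Fin n))ᶜ)
      · rw [Literature.Probability.Percolation.restrW_apply_of_mem w hw]
      · rw [Literature.Probability.Percolation.restrW_apply_of_not_mem w hw]
        exact unitInterval.nonneg'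
  have hmono := prodBernoulli_real_mono_of_isUpperSet hle (isUpperSet_openConn a b) (pocketGlue_measurableSet _)
  have haOc : a ∈ ((↑O : Set (Fin n))ᶜ) := fun h => haO (Finset.mem_coe.1 h)
  have hr := Literature.Probability.Percolation.prodBernoulli_restrW_real_biUnion_openConn w
    ((↑O : Set (Fin n))ᶜ) haOc ({b} : Set (Fin n))
  rw [Set.biUnion_singleton, Set.biUnion_singleton] at hr
  rw [probReal_compl_eq_one_sub (pocketGlue_measurableSet _),
    probReal_compl_eq_one_sub (pocketGlue_measurableSet _)]
  linarith

/-- **Core bridge.**  For a vertex set `O`, `a ∉ O` and any `b`: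
`μ(O ↮ b) · μ_{G−O}(a ↮ b) ≤ μ(a ↮ b)` (Harris for two decreasing events). [this work; cite: Grimmett1999, Thm. (2.4) p. 34] -/
theorem coreBridge (w : Sym2 (Fin n) → unitInterval) (O : Finset (Fin n)) (a b : Fin n) (haO : a ∉ O) :
    (prodBernoulli w).real (⋃ o ∈ O, (openConn o b : Set (BondConfig (Fin n))))ᶜ *
        (prodBernoulli (fun e : Sym2 (Fin n) => if (∃ x ∈ e, x ∈ O) then 0 else w e)).real (openConn a b)ᶜ ≤
      (prodBernoulli w).real (openConn a b)ᶜ := by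
  have h1 := kill_compl_le_openConnIn w O a b haO
  have hupU : IsUpperSet (⋃ o ∈ O, (openConn o b : Set (BondConfig (Fin n)))) := by
    intro ω ω' hle hω
    simp only [Set.mem_iUnion, exists_prop] at hω ⊢
    obtain ⟨o, ho, h⟩ := hω
    exact ⟨o, ho, isUpperSet_openConn o b hle h⟩
  have hlowO : IsLowerSet ((⋃ o ∈ O, (openConn o b : Set (BondConfig (Fin n))))ᶜ) := hupU.compl
  have hlowa : IsLowerSet ((openConnIn ((↑O : Set (Fin n))ᶜ) a b : Set (BondConfig (Fin n)))ᶜ) :=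
    (isUpperSet_openConnIn _ a b).compl
  have hH := prodBernoulli_harris_lower w hlowO hlowa (pocketGlue_measurableSet _) (pocketGlue_measurableSet _)
  have hsub : (⋃ o ∈ O, (openConn o b : Set (BondConfig (Fin n))))ᶜ ∩ (openConnIn ((↑O : Set (Fin n))ᶜ) a b)ᶜ ⊆
      (openConn a b)ᶜ := by
    intro ω hω hab
    exact hω.2 (openConn_diff_blockReach_subset_openConnIn O a b ⟨hab, hω.1⟩)
  have hm := measureReal_mono hsub (measure_ne_top (prodBernoulli w) _)
  calc (prodBernoulli w).real (⋃ o ∈ O, (openConn o b : Set (BondConfig (Fin n))))ᶜ *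
        (prodBernoulli (fun e : Sym2 (Fin n) => if (∃ x ∈ e, x ∈ O) then 0 else w e)).real (openConn a b)ᶜ
      ≤ (prodBernoulli w).real (⋃ o ∈ O, (openConn o b : Set (BondConfig (Fin n))))ᶜ *
          (prodBernoulli w).real (openConnIn ((↑O : Set (Fin n))ᶜ) a b)ᶜ :=
        mul_le_mul_of_nonneg_left h1 measureReal_nonneg
    _ ≤ (prodBernoulli w).real ((⋃ o ∈ O, (openConn o b : Set (BondConfig (Fin n))))ᶜ ∩
          (openConnIn ((↑O : Set (Fin n))ᶜ) a b)ᶜ) := hH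
    _ ≤ (prodBernoulli w).real (openConn a b)ᶜ := hm

/-! ### Conjecture 3 for cores with depth-two exterior -/

/-- **`μ(O ↮ b) ≤ μ(O ↮ A) + √t`** for a core `O` (disjoint from `A ∋ b`) with depth-two exterior, whenever
`μ(a ↮ b) ≤ t` for all `a ∈ A`. [this work; cite: KozmaNitzan2024, Conjecture 3 (p. 15)] -/
theorem core_nearOneGluing (w : Sym2 (Fin n) → unitInterval) (O A : Finset (Fin n)) (b : Fin n) (t : ℝ)
    (hbA : b ∈ A) (hOA : Disjoint O A)
    (hpend : ∀ x : Fin n, x ∉ O → x ∉ A → (∃ o ∈ O, w s(o, x) ≠ 0) →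
      ∀ y : Fin n, y ∉ O → y ∉ A → y ≠ x → w s(x, y) = 0)
    (hrel : ∀ a ∈ A, (prodBernoulli w).real (openConn a b)ᶜ ≤ t) :
    (prodBernoulli w).real (⋃ o ∈ O, (openConn o b : Set (BondConfig (Fin n))))ᶜ ≤
      (prodBernoulli w).real (⋃ o ∈ O, ⋃ x ∈ A, (openConn o x : Set (BondConfig (Fin n))))ᶜ + Real.sqrt t := by
  set μ := prodBernoulli w with hμ
  set kw : Sym2 (Fin n) → unitInterval := fun e => if (∃ x ∈ e, x ∈ O) then 0 else w e with hkw
  have hAne : A.Nonempty := ⟨b, hbA⟩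
  obtain ⟨aStar, haStar, hmax⟩ := Finset.exists_max_image A
    (fun a => (prodBernoulli kw).real (openConn a b)ᶜ) hAne
  set θ : ℝ := (prodBernoulli kw).real (openConn aStar b)ᶜ with hθ
  have ht0 : 0 ≤ t := le_trans measureReal_nonneg (hrel b hbA)
  have hglue := coreGluing w O A b θ hbA hOA hpend (fun a ha => hmax a ha)
  have haO : aStar ∉ O := fun h => Finset.disjoint_left.1 hOA h haStar
  have hbr : μ.real (⋃ o ∈ O, (openConn o b : Set (BondConfig (Fin n))))ᶜ * θ ≤ t :=
    le_trans (coreBridge w O aStar b haO) (hrel aStar haStar)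
  have hcA : μ.real (⋃ o ∈ O, ⋃ x ∈ A, (openConn o x : Set (BondConfig (Fin n))))ᶜ =
      1 - μ.real (⋃ o ∈ O, ⋃ x ∈ A, (openConn o x : Set (BondConfig (Fin n)))) :=
    probReal_compl_eq_one_sub (pocketGlue_measurableSet _)
  have hcb : μ.real (⋃ o ∈ O, (openConn o b : Set (BondConfig (Fin n))))ᶜ =
      1 - μ.real (⋃ o ∈ O, (openConn o b : Set (BondConfig (Fin n)))) :=
    probReal_compl_eq_one_sub (pocketGlue_measurableSet _)
  have h1 : μ.real (⋃ o ∈ O, (openConn o b : Set (BondConfig (Fin n))))ᶜ ≤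
      μ.real (⋃ o ∈ O, ⋃ x ∈ A, (openConn o x : Set (BondConfig (Fin n))))ᶜ + θ := by
    rw [hcA, hcb]; linarith
  exact le_add_sqrt_of_dichotomy measureReal_nonneg ht0 h1 hbr

/-- **Conjecture 3 for an observer inside a core with depth-two exterior.**  For `o ∈ O`, `O` disjoint from
`A ∋ b` with depth-two exterior and `μ(a ↮ b) ≤ t` for all `a ∈ A`:
`μ(o ↮ b) ≤ μ(o ↮ A) + √t + Σ_{z ∈ O∖{o}} μ(o ↮ z)` — the last sum is the cohesion defect of the core seen from
`o` (zero when `o` is glued to the core). [this work; cite: KozmaNitzan2024, Conjecture 3 (p. 15)] -/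
theorem coreObserver_nearOneGluing (w : Sym2 (Fin n) → unitInterval) (O A : Finset (Fin n)) (o b : Fin n)
    (t : ℝ) (hoO : o ∈ O) (hbA : b ∈ A) (hOA : Disjoint O A)
    (hpend : ∀ x : Fin n, x ∉ O → x ∉ A → (∃ o' ∈ O, w s(o', x) ≠ 0) →
      ∀ y : Fin n, y ∉ O → y ∉ A → y ≠ x → w s(x, y) = 0)
    (hrel : ∀ a ∈ A, (prodBernoulli w).real (openConn a b)ᶜ ≤ t) :
    (prodBernoulli w).real (openConn o b)ᶜ ≤
      (prodBernoulli w).real (⋃ a ∈ A, (openConn o a : Set (BondConfig (Fin n))))ᶜ + Real.sqrt t +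
        ∑ z ∈ O.erase o, (prodBernoulli w).real (openConn o z)ᶜ := by
  set μ := prodBernoulli w with hμ
  have hcore := core_nearOneGluing w O A b t hbA hOA hpend hrel
  -- `{o ↮ b} ⊆ {O ↮ b} ∪ ⋃_{z ∈ O∖{o}} {o ↮ z}`
  have hsplit : (openConn o b : Set (BondConfig (Fin n)))ᶜ ⊆
      (⋃ o' ∈ O, (openConn o' b : Set (BondConfig (Fin n))))ᶜ ∪
        ⋃ z ∈ O.erase o, (openConn o z : Set (BondConfig (Fin n)))ᶜ := by
    intro ω hob
    by_cases hOb : ω ∈ ⋃ o' ∈ O, (openConn o' b : Set (BondConfig (Fin n)))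
    · right
      simp only [Set.mem_iUnion, exists_prop] at hOb ⊢
      obtain ⟨z, hz, hzb⟩ := hOb
      have hzo : z ≠ o := by rintro rfl; exact hob hzb
      refine ⟨z, Finset.mem_erase.2 ⟨hzo, hz⟩, fun hoz => hob ?_⟩
      exact SimpleGraph.Reachable.trans hoz hzb
    · left; exact hOb
  -- `{O ↮ A} ⊆ {o ↮ A}`
  have hA : (⋃ o' ∈ O, ⋃ x ∈ A, (openConn o' x : Set (BondConfig (Fin n))))ᶜ ⊆
      (⋃ a ∈ A, (openConn o a : Set (BondConfig (Fin n))))ᶜ := by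
    intro ω hω hoa
    apply hω
    simp only [Set.mem_iUnion, exists_prop] at hoa ⊢
    obtain ⟨a, ha, h⟩ := hoa
    exact ⟨o, hoO, a, ha, h⟩
  have hmA := measureReal_mono hA (measure_ne_top μ _)
  have hm1 := measureReal_mono hsplit (measure_ne_top μ _)
  have hm2 : μ.real ((⋃ o' ∈ O, (openConn o' b : Set (BondConfig (Fin n))))ᶜ ∪
        ⋃ z ∈ O.erase o, (openConn o z : Set (BondConfig (Fin n)))ᶜ) ≤
      μ.real (⋃ o' ∈ O, (openConn o' b : Set (BondConfig (Fin n))))ᶜ +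
        μ.real (⋃ z ∈ O.erase o, (openConn o z : Set (BondConfig (Fin n)))ᶜ) := measureReal_union_le _ _
  have hm3 : μ.real (⋃ z ∈ O.erase o, (openConn o z : Set (BondConfig (Fin n)))ᶜ) ≤
      ∑ z ∈ O.erase o, μ.real (openConn o z)ᶜ := measureReal_biUnion_finset_le _ _
  linarith

end

end Summit.CriticalPhenomena.PercolationContinuityZ3.Theorems
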